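import Literature.Analysis.FluidPDE.NSLerayHopfABCEigenmode
import HarnessLib

/-!
# Albritton–Brué–Colombo 2022, Thm. 1.3 (a): the unstable eigenmode of `L_ss` (named fact), and
  Thm. 1.2 (`albritton_brue_colombo_unit`) assembled from it

Librarian fact-decomposition (libsplit-27, 2026-08-16) of the capped named fact
`Literature.Analysis.FluidPDE.albritton_brue_colombo_unit` (`NSLerayHopfABCScaling.lean`: Albritton–
Brué–Colombo, Ann. of Math. 196 (2022) = arXiv:2112.03116 [ABC], **Thm. 1.2**, faithful
unit-viscosity rendering). The proving seat closed everything in [ABC] DOWNSTREAM of Thm. 1.3 (a):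
`NSLerayHopfABCAssembly.lean` (profile data ⟹ Thm. 1.2), `NSLerayHopfABCLinearization.lean` (the
symmetric split `Ū ± ½W` removes the nonlinear instability Thm. 1.3 (b) / Thm. 4.1 from the line),
`NSLerayHopfABCEigenmode.lean` (`albritton_brue_colombo_unit_of_eigenmode`: an eigenmode
`L_ss η = λη`, `Re λ ≥ 0`, of the operator (1.10) VERBATIM — `AlbrittonBrueColombo2022.negLss`, with
the classical Leray projection — gives Thm. 1.2). What remains is exactly [ABC] **Thm. 1.3 (a)**
(= Cor. 3.2 ∘ Thm. 3.1 ∘ Prop. 2.6 ∘ §2, Vishik's unstable vortex): the EXISTENCE of a smooth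
compactly supported divergence-free profile `Ū` whose linearised similarity operator `L_ss` has an
unstable eigenvalue with a non-trivial smooth eigenfunction in `∩ₖ Hᵏ`. This file

* vendors that statement as ONE child named fact `AlbrittonBrueColombo2022_unstableEigenmode`
  (a `def … : Prop`, not proved: the spectral core of the paper — spectral theory of a
  non-self-adjoint operator on `L²_σ(ℝ³)` — is neither in Mathlib nor in the tree), and
* PROVES the assembly `albritton_brue_colombo_unit_holds_of :
    AlbrittonBrueColombo2022_unstableEigenmode → albritton_brue_colombo_unit`
  (one line over `albritton_brue_colombo_unit_of_eigenmode`).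

## The child, and how it is weaker than print

Printed (Thm. 1.3): "There exists a smooth, compactly supported velocity profile `Ū` [divergence
free: a steady state of (1.9); §4: "Let `Ū` be a compactly supported, smooth, divergence-free vector
field"] … (a) The linearized operator `L_ss` defined in (1.10) has an unstable eigenvalue `λ` with
non-trivial smooth eigenfunction `η` belonging to `Hᵏ(ℝ³)` for all `k ≥ 0`: `L_ss η = λη` and
`a := Re λ > 0`." Here `−L_ss U = −½(1 + ξ·∇)U − ΔU + P(Ū·∇U + U·∇Ū)` (1.10), `P` the Leray projector.
Tree form: `λ = a + ib`, `η = η₁ + iη₂` with REAL fields `η₁, η₂ : ℝ³ → ℝ³`; the equation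
`L_ss η = λη`, i.e. `λη + (−L_ss)η = 0`, in real and imaginary parts
(`aη₁ − bη₂ + negLss Ū η₁ = 0`, `bη₁ + aη₂ + negLss Ū η₂ = 0`, pointwise, classically); of
`η ∈ ∩ₖ Hᵏ` only the consequences `ηⱼ ∈ C^∞ ∩ L^∞ ∩ L² ∩ Ḣ¹` are recorded (Sobolev embedding), and
`η ∈ L²_σ` is recorded as `div ηⱼ = 0`; "non-trivial" is recorded after the harmless normalisation
`Re η ≢ 0` (replace `η` by `iη` if `Re η ≡ 0`). Every clause is implied by the printed theorem, so
the child is (slightly) WEAKER than print and exactly what the assembly consumes. It does not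
restate the parent: it is a statement about the spectrum of a linear operator in similarity
variables, not about Leray–Hopf solutions.

## References

* D. Albritton, E. Brué, M. Colombo, *Non-uniqueness of Leray solutions of the forced
  Navier–Stokes equations*, Ann. of Math. 196 (2022) 415–455 = arXiv:2112.03116: §1.1 (1.10),
  Thm. 1.2, Thm. 1.3 (a); §2 (Thm. 2.1 Vishik, Prop. 2.2, Cor. 2.3, Prop. 2.6), §3 (Thm. 3.1,
  Cor. 3.2). [AlbrittonBrueColombo2022]
* M. Vishik, *Instability and non-uniqueness in the Cauchy problem for the Euler equations of an
  ideal incompressible fluid*, Parts I–II, arXiv:1805.09426 / 1805.09440 (2018) — the unstable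
  vortex (context; not vendored here).
-/

noncomputable section

open MeasureTheory Set Function
open scoped ENNReal ContDiff

namespace Literature.Analysis.FluidPDE

open AlbrittonBrueColombo2022

/-- **Albritton–Brué–Colombo 2022, Thm. 1.3 (a) (the unstable eigenmode; NAMED FACT, not proved
here).** Printed: "There exists a smooth, compactly supported velocity profile `Ū` … such that the
linearized operator `L_ss` defined in (1.10) has an unstable eigenvalue `λ` with non-trivial smooth
eigenfunction `η` belonging to `Hᵏ(ℝ³)` for all `k ≥ 0`: `L_ss η = λη` and `a := Re λ > 0`", where
`−L_ss U = −½(1 + ξ·∇)U − ΔU + P(Ū·∇U + U·∇Ū)`, `P` the Leray projector (= Cor. 3.2 with Thm. 3.1,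
Prop. 2.6 and Vishik's unstable vortex, §2). Tree form: there are `Ū : ℝ³ → ℝ³` smooth, compactly
supported, divergence free, reals `a > 0`, `b` (`λ = a + ib`) and smooth divergence-free real fields
`η₁, η₂` (`η = η₁ + iη₂`), bounded and in `L² ∩ Ḣ¹`, with `Re η = η₁ ≢ 0`, solving `L_ss η = λη`
classically in real and imaginary parts, `−L_ss = AlbrittonBrueColombo2022.negLss Ū` ((1.10) verbatim,
with the classical Leray projection). Weaker than print (only `C^∞ ∩ L^∞ ∩ L² ∩ Ḣ¹` of `η ∈ ∩ₖHᵏ` is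
kept; `Re η ≢ 0` is a normalisation of "non-trivial"). The one child of the decomposition of
`albritton_brue_colombo_unit` (assembly `albritton_brue_colombo_unit_holds_of`).
[cite: AlbrittonBrueColombo2022, Thm. 1.3 (a) with (1.10); Cor. 3.2] -/
def AlbrittonBrueColombo2022_unstableEigenmode : Prop :=
  ∃ (Ubar : EuclideanSpace ℝ (Fin 3) → EuclideanSpace ℝ (Fin 3)),
    ContDiff ℝ ∞ Ubar ∧ HasCompactSupport Ubar ∧ VectorCalculus.IsDivFree Ubar ∧
    ∃ (a b : ℝ) (η₁ η₂ : EuclideanSpace ℝ (Fin 3) → EuclideanSpace ℝ (Fin 3)),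
      0 < a ∧ ContDiff ℝ ∞ η₁ ∧ ContDiff ℝ ∞ η₂ ∧
      VectorCalculus.IsDivFree η₁ ∧ VectorCalculus.IsDivFree η₂ ∧
      (∀ ξ, a • η₁ ξ - b • η₂ ξ + negLss Ubar η₁ ξ = 0) ∧
      (∀ ξ, b • η₁ ξ + a • η₂ ξ + negLss Ubar η₂ ξ = 0) ∧
      (∃ K : ℝ, ∀ ξ, ‖η₁ ξ‖ ≤ K ∧ ‖η₂ ξ‖ ≤ K) ∧
      (∫⁻ ξ, ‖η₁ ξ‖ₑ ^ 2) < ⊤ ∧ (∫⁻ ξ, ‖η₂ ξ‖ₑ ^ 2) < ⊤ ∧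
      (∫⁻ ξ, ENNReal.ofReal (frobeniusNormSq (fderiv ℝ η₁ ξ))) < ⊤ ∧
      (∫⁻ ξ, ENNReal.ofReal (frobeniusNormSq (fderiv ℝ η₂ ξ))) < ⊤ ∧
      ∃ ξ₀, η₁ ξ₀ ≠ 0

/-- **Assembly of the decomposition: Thm. 1.3 (a) ⟹ Thm. 1.2.** The named fact
`albritton_brue_colombo_unit` (Albritton–Brué–Colombo 2022, Thm. 1.2, faithful unit-viscosity
rendering) follows from the unstable eigenmode `AlbrittonBrueColombo2022_unstableEigenmode` alone, by
the tree's `albritton_brue_colombo_unit_of_eigenmode` (the symmetric split `Ū ± ½Re(e^{λτ}η)` of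
`NSLerayHopfABCLinearization.lean` / `NSLerayHopfABCEigenmode.lean`, which needs only `Re λ ≥ 0`).
[cite: AlbrittonBrueColombo2022, Thm. 1.3 (a) ⟹ Thm. 1.2] -/
theorem albritton_brue_colombo_unit_holds_of (h : AlbrittonBrueColombo2022_unstableEigenmode) :
    albritton_brue_colombo_unit := by
  obtain ⟨Ubar, hUs, hUc, hUdiv, a, b, η₁, η₂, ha, hη₁, hη₂, hdiv₁, hdiv₂, heig₁, heig₂,
    ⟨K, hK⟩, hI₁, hI₂, hJ₁, hJ₂, hne⟩ := h
  exact albritton_brue_colombo_unit_of_eigenmode hUs hUc hUdiv ha.le hη₁ hη₂ hdiv₁ hdiv₂ heig₁ heig₂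
    (fun ξ => (hK ξ).1) (fun ξ => (hK ξ).2) hI₁ hI₂ hJ₁ hJ₂ hne

/-- Hence also **ns.S20** `albritton_brue_colombo` (every viscosity) from the unstable eigenmode
(`albritton_brue_colombo_of_unit`). [cite: AlbrittonBrueColombo2022, Thm. 1.3 (a) ⟹ Thm. 1.2] -/
theorem albritton_brue_colombo_holds_of_unstableEigenmode
    (h : AlbrittonBrueColombo2022_unstableEigenmode) : albritton_brue_colombo :=
  albritton_brue_colombo_of_unit (albritton_brue_colombo_unit_holds_of h)

end Literature.Analysis.FluidPDE

end
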